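import Mathlib
import HarnessLib
import Literature.Probability.MarkovChains.SpectralProfileComparison

/-!
# The conductance lower bound on the spectral profile `Φ(r)²/2 ≤ Λ(r)` and its rescaled form `Λ^K(r) ≥ Φ^K(r)²/(2(1−α))` (Goel–Montenegro–Tetali 2006, Lemma 2.4 and the rescaling remark of §2.3)

HONEST FRAMING: exact (Metropolis-corrected) sampling algorithms for lattice gauge theory; figures
of merit are autocorrelation/cost numbers at stated couplings and volumes; no continuum-physics claim.

Source (READ on the hub's materialised text): S. Goel, R. Montenegro, P. Tetali, *Mixing time
bounds via the spectral profile*, Electron. J. Probab. **11** (2006) 1–26 = math.PR/0505690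
[GoelMontenegroTetali2006]: §2.2 **LEMMA 2.4** ("`Φ²(r)/2 ≤ Λ(r) ≤ Φ(r)/(1−r)`"; its proof shows
"the Cheeger inequality `Φ²(π(A))/2 ≤ λ₀(A)`", typed in SET FORM in `RestrictedCheegerInequality.lean`
as `GoelMontenegroTetali2006_lemma_2_4_lower`; the upper bound is `SpectralProfileComparison.lean`'s
`GoelMontenegroTetali2006_lemma_2_4_upper`), and §2.3 "**Improvement for discrete-time using
rescaling**" (p. 7: "Given a Markov kernel `K` let `Λ^K(r)` and `Φ^K(r)` denote the spectral and
conductance profiles, respectively. Then `Λ^K(r) = (1−α)Λ^{(K−αI)/(1−α)}(r) ≥ ((1−α)/2)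
Φ^{(K−αI)/(1−α)}(r)² = ((1−α)/2)(Φ^K(r)/(1−α))² = Φ^K(r)²/(2(1−α))`").  Everything below is PROVED
(0 named facts).

VOCABULARY (the tree's): `λ(S) = dirichletEigenvalue π P S`, `λ₀(S) = dirichletEigenvalue₀ π P S`,
`Λ(r) = spectralProfile π P r` (`SpectralProfile.lean`), `Φ(S) = bottleneckRatio π P S = Q(S,Sᶜ)/π(S)`
with `Q = edgeMeasure` (`BottleneckRatio.lean`), `Φ(r) = conductanceProfile π P r`
(`SpectralProfileComparison.lean`); the rescaled kernel `(K − αI)/(1 − α)` is `rescaleKernel P α`.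

## Content
* `conductanceProfile_le_bottleneckRatio`, `conductanceProfile_nonneg`,
  `conductanceProfile_mul_le_edgeMeasure` (`Φ(r)π(S) ≤ Q(S,Sᶜ)` for `S ⊆ A`, `π(A) ≤ r`);
* **LEMMA 2.4, lower bound**: `GoelMontenegroTetali2006_lemma_2_4_lower_eigenvalue₀` (`Φ(r)²/2 ≤
  λ₀(A)` for `π(A) ≤ r`) and **`GoelMontenegroTetali2006_lemma_2_4_lower_profile`** (`Φ(r)²/2 ≤ Λ(r)`);
* the rescaling remark: `rescaleKernel`, `rescaleKernel_isRowStochastic` (`K(x,x) ≥ α`, `α < 1`),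
  `rescaleKernel_isStationary`, `dirichletForm_rescaleKernel` (`𝓔_{K'} = 𝓔_K/(1−α)`),
  `dirichletEigenvalue_rescaleKernel`, `spectralProfile_rescaleKernel` (`Λ^K = (1−α)Λ^{K'}`),
  `edgeMeasure_rescaleKernel`, `bottleneckRatio_rescaleKernel`, `conductanceProfile_rescaleKernel`
  (`Φ^K = (1−α)Φ^{K'}`), and **`GoelMontenegroTetali2006_spectralProfile_ge_rescaled`**
  (`Λ^K(r) ≥ Φ^K(r)²/(2(1−α))`).

NOT HERE: COROLLARY 2.2 (the discrete-time `L^∞` mixing bound through `Φ`), which needs COROLLARY 2.1.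
-/

namespace Literature.Probability.MarkovChains

open Finset Matrix

variable {X : Type*} [Fintype X] [DecidableEq X] {P : Matrix X X ℝ} {π : X → ℝ}

/-! ## `Φ(r)` against sets -/

section Profile

/-- `Φ(r) ≤ Φ(S)` for every non-empty `S` with `π(S) ≤ r` (`π, P ≥ 0`).
[cite: GoelMontenegroTetali2006, §2.2 Definition 2.2] -/
theorem conductanceProfile_le_bottleneckRatio (hπ0 : ∀ x, 0 ≤ π x) (hP0 : ∀ x y, 0 ≤ P x y)
    {S : Finset X} (hS : S.Nonempty) {r : ℝ} (hr : ∑ x ∈ S, π x ≤ r) :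
    conductanceProfile π P r ≤ bottleneckRatio π P S :=
  csInf_le ⟨0, by rintro _ ⟨T, -, rfl⟩; exact bottleneckRatio_nonneg hπ0 hP0 T⟩ ⟨S, ⟨hS, hr⟩, rfl⟩

/-- `Φ(r) ≥ 0`. [cite: GoelMontenegroTetali2006, §2.2 Definition 2.2] -/
theorem conductanceProfile_nonneg (hπ0 : ∀ x, 0 ≤ π x) (hP0 : ∀ x y, 0 ≤ P x y) (r : ℝ) :
    0 ≤ conductanceProfile π P r :=
  Real.sInf_nonneg (by rintro _ ⟨T, -, rfl⟩; exact bottleneckRatio_nonneg hπ0 hP0 T)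

/-- The cut hypothesis of the set-form Cheeger bound: if `π(A) ≤ r` then **`Φ(r)·π(S) ≤ Q(S,Sᶜ)`
for every `S ⊆ A`** (non-empty `S` has `π(S) ≤ π(A) ≤ r`, so `Φ(r) ≤ Φ(S) = Q(S,Sᶜ)/π(S)`; `S = ∅`
is trivial). [cite: GoelMontenegroTetali2006, §2.2 proof of Lemma 2.4 ("the Cheeger inequality
`Φ²(π(A))/2 ≤ λ₀(A)`")] -/
theorem conductanceProfile_mul_le_edgeMeasure (hπ : ∀ x, 0 < π x) (hP0 : ∀ x y, 0 ≤ P x y)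
    {A : Finset X} {r : ℝ} (hA : ∑ x ∈ A, π x ≤ r) {S : Finset X} (hS : S ⊆ A) :
    conductanceProfile π P r * ∑ x ∈ S, π x ≤ edgeMeasure π P S Sᶜ := by
  have hπ0 : ∀ x, 0 ≤ π x := fun x => (hπ x).le
  rcases S.eq_empty_or_nonempty with hSe | hSne
  · rw [hSe]; simp [edgeMeasure]
  have hπS : 0 < ∑ x ∈ S, π x := sum_pos (fun x _ => hπ x) hSne
  have hSr : ∑ x ∈ S, π x ≤ r := (sum_le_sum_of_subset_of_nonneg hS fun x _ _ => hπ0 x).trans hA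
  have h := conductanceProfile_le_bottleneckRatio hπ0 hP0 hSne hSr (P := P)
  unfold bottleneckRatio at h
  exact (le_div_iff₀ hπS).1 h

/-- **LEMMA 2.4 (lower bound), restricted-eigenvalue form: `Φ(r)²/2 ≤ λ₀(A)`** for every non-empty
`A` with `π(A) ≤ r` (`K` row-stochastic, `π > 0` stationary) — the set-form Cheeger inequality of
`RestrictedCheegerInequality.lean` with `h = Φ(r)`. [cite: GoelMontenegroTetali2006, §2.2 Lemma 2.4
and its proof] -/
theorem GoelMontenegroTetali2006_lemma_2_4_lower_eigenvalue₀ (hπ : ∀ x, 0 < π x)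
    (hP : IsRowStochastic P) (hst : IsStationary π P) {A : Finset X} (hAne : A.Nonempty) {r : ℝ}
    (hA : ∑ x ∈ A, π x ≤ r) :
    conductanceProfile π P r ^ 2 / 2 ≤ dirichletEigenvalue₀ π P A := by
  have hπ0 : ∀ x, 0 ≤ π x := fun x => (hπ x).le
  have hΦ : 0 ≤ conductanceProfile π P r := conductanceProfile_nonneg hπ0 hP.1 r
  -- the index set of `λ₀(A)` is non-empty: the indicator of a point of `A`
  obtain ⟨x₀, hx₀⟩ := hAne
  have hf₀ : (fun x => if x = x₀ then (1:ℝ) else 0) ∈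
      {f : X → ℝ | (∀ x, x ∉ A → f x = 0) ∧ 0 < piInner π f f} := by
    refine ⟨fun x hx => if_neg (fun h : x = x₀ => hx (by rw [h]; exact hx₀)), ?_⟩
    unfold piInner
    have : ∑ x, π x * ((if x = x₀ then (1:ℝ) else 0) * (if x = x₀ then (1:ℝ) else 0)) = π x₀ := by
      rw [sum_eq_single x₀ (fun x _ hx => by simp [hx]) (fun h => absurd (mem_univ x₀) h)]; simp
    rw [this]; exact hπ x₀
  refine le_csInf ⟨_, ⟨_, hf₀, rfl⟩⟩ ?_
  rintro _ ⟨f, ⟨hsupp, hff⟩, rfl⟩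
  rw [le_div_iff₀ hff]
  exact GoelMontenegroTetali2006_lemma_2_4_lower hP hst hπ0 hΦ
    (fun S hS => conductanceProfile_mul_le_edgeMeasure hπ hP.1 hA hS) hsupp

/-- **LEMMA 2.4 (Goel–Montenegro–Tetali 2006), lower bound: `Φ(r)²/2 ≤ Λ(r)`** for `r ≥ π_*` (some
non-empty `S` has `π(S) ≤ r`; `K` row-stochastic, `π > 0` a stationary probability vector, `|X| ≥ 2`),
from `λ(A) ≥ λ₀(A) ≥ Φ²(π(A))/2 ≥ Φ(r)²/2`. [cite: GoelMontenegroTetali2006, §2.2 Lemma 2.4] -/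
theorem GoelMontenegroTetali2006_lemma_2_4_lower_profile [Nontrivial X] (hπ : ∀ x, 0 < π x)
    (hπ1 : ∑ x, π x = 1) (hP : IsRowStochastic P) (hst : IsStationary π P) {r : ℝ}
    (hr : ∃ S : Finset X, S.Nonempty ∧ ∑ x ∈ S, π x ≤ r) :
    conductanceProfile π P r ^ 2 / 2 ≤ spectralProfile π P r := by
  obtain ⟨S₀, hS₀, hS₀r⟩ := hr
  refine le_csInf ⟨_, ⟨S₀, ⟨hS₀, hS₀r⟩, rfl⟩⟩ ?_
  rintro _ ⟨A, ⟨hA, hAr⟩, rfl⟩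
  exact (GoelMontenegroTetali2006_lemma_2_4_lower_eigenvalue₀ hπ hP hst hA hAr).trans
    (dirichletEigenvalue₀_le_dirichletEigenvalue hπ hπ1 hP.1 hA)

end Profile

/-! ## The rescaling remark: `K' = (K − αI)/(1 − α)` -/

section Rescale

/-- The RESCALED KERNEL `K' = (K − αI)/(1 − α)` of a kernel with holding `K(x,x) ≥ α`
(`0 ≤ α < 1`). [cite: GoelMontenegroTetali2006, §2.3 "Improvement for discrete-time using rescaling"] -/
noncomputable def rescaleKernel (P : Matrix X X ℝ) (α : ℝ) : Matrix X X ℝ :=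
  fun x y => (P x y - if x = y then α else 0) / (1 - α)

omit [Fintype X] in
/-- Off the diagonal `K'(x,y) = K(x,y)/(1−α)`. [cite: GoelMontenegroTetali2006, §2.3 (rescaling)] -/
theorem rescaleKernel_of_ne {α : ℝ} {x y : X} (hxy : x ≠ y) :
    rescaleKernel P α x y = P x y / (1 - α) := by
  simp [rescaleKernel, hxy]

/-- `K'` is a Markov kernel when `K(x,x) ≥ α` and `α < 1`. [cite: GoelMontenegroTetali2006, §2.3
(rescaling: "Given a Markov kernel `K`" with holding probability `α`)] -/
theorem rescaleKernel_isRowStochastic (hP : IsRowStochastic P) {α : ℝ} (hα : α < 1)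
    (hdiag : ∀ x, α ≤ P x x) : IsRowStochastic (rescaleKernel P α) := by
  have h1 : 0 < 1 - α := by linarith
  refine ⟨fun x y => div_nonneg ?_ h1.le, fun x => ?_⟩
  · by_cases hxy : x = y
    · subst hxy; simp only [if_true]; linarith [hdiag x]
    · rw [if_neg hxy, sub_zero]; exact hP.1 x y
  · unfold rescaleKernel
    rw [← sum_div, sum_sub_distrib, hP.2 x, sum_ite_eq, if_pos (mem_univ x), div_self h1.ne']

/-- `π` stays stationary for `K'`. [cite: GoelMontenegroTetali2006, §2.3 (rescaling)] -/
theorem rescaleKernel_isStationary (hst : IsStationary π P) {α : ℝ} (hα : α < 1) :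
    IsStationary π (rescaleKernel P α) := by
  have h1 : (1 : ℝ) - α ≠ 0 := by linarith
  intro y
  unfold rescaleKernel
  have e : ∀ x, π x * ((P x y - if x = y then α else 0) / (1 - α)) =
      (π x * P x y - if x = y then π x * α else 0) / (1 - α) := fun x => by
    split_ifs <;> ring
  simp_rw [e]
  rw [← sum_div, sum_sub_distrib, hst y, sum_ite_eq' univ y, if_pos (mem_univ y)]
  field_simp

/-- **`𝓔_{K'}(f,f) = 𝓔_K(f,f)/(1 − α)`** (the diagonal does not enter the Dirichlet form).
[cite: GoelMontenegroTetali2006, §2.3 (rescaling: "`Λ^K(r) = (1−α)Λ^{(K−αI)/(1−α)}(r)`")] -/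
theorem dirichletForm_rescaleKernel (α : ℝ) (f : X → ℝ) :
    dirichletForm π (rescaleKernel P α) f = dirichletForm π P f / (1 - α) := by
  unfold dirichletForm
  rw [mul_div_assoc]
  congr 1
  rw [sum_div]
  refine sum_congr rfl fun x _ => ?_
  rw [sum_div]
  refine sum_congr rfl fun y _ => ?_
  by_cases hxy : x = y
  · subst hxy; simp
  · rw [rescaleKernel_of_ne hxy]; ring

/-- **`λ_{K'}(S) = λ_K(S)/(1 − α)`** (`α < 1`). [cite: GoelMontenegroTetali2006, §2.3 (rescaling:
"`Λ^K(r) = (1−α)Λ^{(K−αI)/(1−α)}(r)`")] -/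
theorem dirichletEigenvalue_rescaleKernel {α : ℝ} (hα : α < 1) (S : Finset X) :
    dirichletEigenvalue π (rescaleKernel P α) S = dirichletEigenvalue π P S / (1 - α) := by
  have h1 : 0 < 1 - α := by linarith
  unfold dirichletEigenvalue
  have e : (fun f : X → ℝ => dirichletForm π (rescaleKernel P α) f / lawVariance π f) =
      (fun t : ℝ => (1 - α)⁻¹ • t) ∘ (fun f : X → ℝ => dirichletForm π P f / lawVariance π f) := by
    funext f; simp only [Function.comp, smul_eq_mul, dirichletForm_rescaleKernel]; ring
  rw [e, Set.image_comp, Set.image_smul, Real.sInf_smul_of_nonneg (inv_nonneg.2 h1.le), smul_eq_mul]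
  ring

/-- **`Λ^K(r) = (1 − α)Λ^{K'}(r)`**, typed as `Λ^{K'}(r) = Λ^K(r)/(1 − α)`.
[cite: GoelMontenegroTetali2006, §2.3 (rescaling)] -/
theorem spectralProfile_rescaleKernel {α : ℝ} (hα : α < 1) (r : ℝ) :
    spectralProfile π (rescaleKernel P α) r = spectralProfile π P r / (1 - α) := by
  have h1 : 0 < 1 - α := by linarith
  unfold spectralProfile
  have e : (fun S : Finset X => dirichletEigenvalue π (rescaleKernel P α) S) =
      (fun t : ℝ => (1 - α)⁻¹ • t) ∘ (fun S : Finset X => dirichletEigenvalue π P S) := by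
    funext S; simp only [Function.comp, smul_eq_mul, dirichletEigenvalue_rescaleKernel hα]; ring
  rw [e, Set.image_comp, Set.image_smul, Real.sInf_smul_of_nonneg (inv_nonneg.2 h1.le), smul_eq_mul]
  ring

/-- `Q_{K'}(S,Sᶜ) = Q_K(S,Sᶜ)/(1 − α)` (only off-diagonal entries enter). [cite: GoelMontenegroTetali2006,
§2.3 (rescaling: "`Φ^{(K−αI)/(1−α)}(r) = Φ^K(r)/(1−α)`")] -/
theorem edgeMeasure_rescaleKernel (α : ℝ) (S : Finset X) :
    edgeMeasure π (rescaleKernel P α) S Sᶜ = edgeMeasure π P S Sᶜ / (1 - α) := by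
  unfold edgeMeasure
  rw [sum_div]
  refine sum_congr rfl fun x hx => ?_
  rw [sum_div]
  refine sum_congr rfl fun y hy => ?_
  have hxy : x ≠ y := fun h => (mem_compl.1 hy) (h ▸ hx)
  rw [rescaleKernel_of_ne hxy]; ring

/-- `Φ_{K'}(S) = Φ_K(S)/(1 − α)`. [cite: GoelMontenegroTetali2006, §2.3 (rescaling)] -/
theorem bottleneckRatio_rescaleKernel (α : ℝ) (S : Finset X) :
    bottleneckRatio π (rescaleKernel P α) S = bottleneckRatio π P S / (1 - α) := by
  unfold bottleneckRatio
  rw [edgeMeasure_rescaleKernel]; ring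

/-- **`Φ^K(r) = (1 − α)Φ^{K'}(r)`**, typed as `Φ^{K'}(r) = Φ^K(r)/(1 − α)`.
[cite: GoelMontenegroTetali2006, §2.3 (rescaling)] -/
theorem conductanceProfile_rescaleKernel {α : ℝ} (hα : α < 1) (r : ℝ) :
    conductanceProfile π (rescaleKernel P α) r = conductanceProfile π P r / (1 - α) := by
  have h1 : 0 < 1 - α := by linarith
  unfold conductanceProfile
  have e : (fun S : Finset X => bottleneckRatio π (rescaleKernel P α) S) =
      (fun t : ℝ => (1 - α)⁻¹ • t) ∘ (fun S : Finset X => bottleneckRatio π P S) := by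
    funext S; simp only [Function.comp, smul_eq_mul, bottleneckRatio_rescaleKernel]; ring
  rw [e, Set.image_comp, Set.image_smul, Real.sInf_smul_of_nonneg (inv_nonneg.2 h1.le), smul_eq_mul]
  ring

/-- **The rescaling remark (Goel–Montenegro–Tetali 2006): `Λ^K(r) ≥ Φ^K(r)²/(2(1 − α))`** for a
kernel with holding `K(x,x) ≥ α` (`0 ≤ α < 1`; `π > 0` stationary, `|X| ≥ 2`, `r ≥ π_*`), from
LEMMA 2.4 for `K' = (K − αI)/(1 − α)`: "`Λ^K(r) = (1−α)Λ^{K'}(r) ≥ ((1−α)/2)Φ^{K'}(r)² =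
Φ^K(r)²/(2(1−α))`". [cite: GoelMontenegroTetali2006, §2.3 "Improvement for discrete-time using
rescaling"] -/
theorem GoelMontenegroTetali2006_spectralProfile_ge_rescaled [Nontrivial X] (hπ : ∀ x, 0 < π x)
    (hπ1 : ∑ x, π x = 1) (hP : IsRowStochastic P) (hst : IsStationary π P) {α : ℝ} (hα : α < 1)
    (hdiag : ∀ x, α ≤ P x x) {r : ℝ} (hr : ∃ S : Finset X, S.Nonempty ∧ ∑ x ∈ S, π x ≤ r) :
    conductanceProfile π P r ^ 2 / (2 * (1 - α)) ≤ spectralProfile π P r := by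
  have h1 : 0 < 1 - α := by linarith
  have h := GoelMontenegroTetali2006_lemma_2_4_lower_profile hπ hπ1
    (rescaleKernel_isRowStochastic hP hα hdiag) (rescaleKernel_isStationary hst hα) hr
  rw [conductanceProfile_rescaleKernel hα, spectralProfile_rescaleKernel hα, div_pow,
    le_div_iff₀ h1] at h
  calc conductanceProfile π P r ^ 2 / (2 * (1 - α))
      = conductanceProfile π P r ^ 2 / (1 - α) ^ 2 / 2 * (1 - α) := by field_simp
    _ ≤ spectralProfile π P r := h

end Rescale

end Literature.Probability.MarkovChains
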